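import Literature.AnabelianGeometry.SemiGraphs.TemperedPiEdgeConjugators
import Literature.AnabelianGeometry.SemiGraphs.GaloisLevelDataChart
import Literature.AnabelianGeometry.SemiGraphs.TemperedCompactInVerticialFinite
import HarnessLib

/-!
# [SemiAnbd] Thm 5.4, producer row T54-B: `hP` (vertex AND edge conjugators) for the presentation of `𝔾`
# in `π₁^temp(𝒢)` at an ARBITRARY cofinal Galois tower `D` and ITS chart `D.chart` (E1-junction currency)

Mochizuki, *Semi-graphs of anabelioids*, Publ. RIMS **42** (2006), §3 Prop 3.6 (i)(ii) p. 38, Thm 3.7 (i)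
p. 40, §5 p. 65, Thm 5.4 p. 66 [cite: MochizukiSemiAnbd2006, Thm 5.4, p. 66].  abc-iut cell, layer L3,
GAP-LEDGER row G-w4d053-1 (T54-B); seat abc-iut-w4-d053 gen 3.  PROOF-ONLY (no definition, no named fact).

WHY.  The E1 junction (abc-iut-L3-t9, D-G-w4d053-1 (J1)–(J3)) moves the Thm 5.4 capstone from the fixed
enumeration `𝒢.galoisLevelData h36` (whose finite levels are not `E`-stable) to a CHARACTERISTIC tower
`D_char` with its own Prop 3.6 chart `D_char.chart …` (GaloisLevelDataChart.lean, p432226).  Every input of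
the capstone's `hP` that was pinned to `(𝒢.galoisLevelData h36, 𝒢.temperedPiChart h36)` must therefore be
available at `(D, D.chart …)` for an ARBITRARY tower `D` (cofinal `hcof`, self-split finite nonempty levels).
This file re-instantiates them VERBATIM (proof bodies unchanged; only the chart term changes):

* ROOT: `PointSeq.isVerticialHom_decompHomCont_chart` / `…range_decompHom_mem_verticialSubgroups_chart` —
  the decomposition homomorphism of a compatible point sequence of `D` is VERTICIAL for `D.chart` (the
  fibre isomorphisms of abc-iut-L3-t9/t8's `PointSeq.fibreIso` + t9's generic `D.levelOf`);
* abc-iut-w4-d082's three OuterCompat lemmas at `D.chart`: `piPresentation_exists_isVConj_outerAction_chart`,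
  `piPresentation_M_mem_edgeLikeSubgroups_chart`, `piPresentation_selfNormalizing_chart`;
* this seat's TemperedPiEdgeConjugators §2–§3 at `D.chart`: `piPresentation_hBR_outerAction_chart`,
  `piPresentation_map_conj_H_mem_verticialSubgroups_chart`, `piPresentation_hNe_chart`,
  `piPresentation_hTwo_chart`, `piPresentation_hVconj_outerAction_chart`, and the assembly
  **`isArithCompatible_piPresentation_outerAction_of_branchPair_chart`** (+ `_of_finite`, Thm 3.7 (iii) at
  `𝒢` by abc-iut-L3-t8's `compactInVerticialAt_of_finiteGraph`) = the `hP` input of the capstone at ANY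
  tower, modulo the Def 5.1 (i) chart binders `hV`/`hBR` read at `D.chart`.

Nothing here takes a side on [IUTchIII] Cor 3.12; typed ≠ proved for Thm 5.4.
-/

namespace Literature.AnabelianGeometry.SemiGraphs

namespace ProfiniteSemiGraph

open CategoryTheory
open Literature.AnabelianGeometry.EtaleTheta

universe u w

variable {𝒢 : ProfiniteSemiGraph.{u}}

namespace GaloisLevelData

/-! ### Root: decomposition homomorphisms are verticial for the chart of the tower -/

namespace PointSeq

variable {D : GaloisLevelData 𝒢} {h𝒢 : 𝒢.IsCountable}
  (hcof : ∀ (T : CovObj 𝒢), T.IsTempered → ∀ p : T.Point,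
    ∃ i : ℕ, ∀ j, i ≤ j → (D.S j).Splits (T.component p))
  (hcn : 𝒢.graph.IsConnected) (hS : ∀ n, (D.S n).Splits (D.S n)) (hfin : ∀ n, (D.S n).IsFinite)
  (hne : ∀ n, (D.S n).HasNonemptyFibres) {v : 𝒢.graph.Vertex} (P : D.PointSeq h𝒢 v)

/-- **The decomposition homomorphism `Π_v → π₁^temp(𝒢)` of a compatible point sequence of ANY cofinal
Galois tower `D` is VERTICIAL for the chart `D.chart` of that tower** (restriction to `v` ≅ fibre functor ⋙
`B^temp(P.decompHom)`, by the fibre isomorphisms). [cite: MochizukiSemiAnbd2006, Thm 3.7(i) p.40] -/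
theorem isVerticialHom_decompHomCont_chart :
    IsVerticialHom (D.chart h𝒢 hcof hcn hS hfin hne) v P.decompHomCont :=
  (isVerticialHom_iff_nonempty_functorIso _ v _).2
    ⟨NatIso.ofComponents
      (fun T => P.fibreIso hcn T.obj (D.levelOf hcof T) (D.levelOf_spec hcof T))
      (fun {T T'} f => P.restrictV_map_comp_fibreIso_hom hcn T.obj (D.levelOf hcof T)
        (D.levelOf_spec hcof T) f.hom (D.levelOf hcof T') (D.levelOf_spec hcof T'))⟩

/-- The image of a decomposition homomorphism is a verticial subgroup for `D.chart`.
[cite: MochizukiSemiAnbd2006, Thm 3.7(i) p.40] -/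
theorem range_decompHom_mem_verticialSubgroups_chart :
    (P.decompHom).range ∈ verticialSubgroups (D.chart h𝒢 hcof hcn hS hfin hne) v :=
  ⟨P.decompHomCont, P.isVerticialHom_decompHomCont_chart hcof hcn hS hfin hne, rfl⟩

end PointSeq

end GaloisLevelData

/-! ### The OuterCompat lemmas and the edge conjugators at `D.chart` -/

section Chart

variable (D : GaloisLevelData 𝒢) (h𝒢 : 𝒢.IsCountable)
  (hcof : ∀ (T : CovObj 𝒢), T.IsTempered → ∀ p : T.Point,
    ∃ i : ℕ, ∀ j, i ≤ j → (D.S j).Splits (T.component p))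
  (hcn : 𝒢.graph.IsConnected) (hS : ∀ n, (D.S n).Splits (D.S n)) (hfin : ∀ n, (D.S n).IsFinite)
  (hne : ∀ n, (D.S n).HasNonemptyFibres)
  (T : ∀ w : 𝒢.graph.Vertex, D.PointSeq h𝒢 w) (R : SemiGraph.RefBranches 𝒢.graph)

/-- The edge groups of the presentation are edge-like for `D.chart` (abc-iut-w4-d082's
`piPresentation_M_mem_edgeLikeSubgroups` at the chart of the tower). [cite: MochizukiSemiAnbd2006, Thm 3.7(iii) p.41] -/
theorem piPresentation_M_mem_edgeLikeSubgroups_chart (ε : 𝒢.graph.Edge) :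
    (D.piPresentation h𝒢 T R).M ε ∈ edgeLikeSubgroups (D.chart h𝒢 hcof hcn hS hfin hne) ε := by
  have hmem : ((𝒢.branchSubgroup (R.β ε) (R.ν ε) (R.abuts_β ε)).map (T (R.ν ε)).decompHom) ∈
      edgeLikeSubgroups (D.chart h𝒢 hcof hcn hS hfin hne) (𝒢.graph.edgeOf (R.β ε)) :=
    ⟨(T (R.ν ε)).decompHomCont.comp (𝒢.brHom (R.β ε) (R.ν ε) (R.abuts_β ε)),
      isEdgeHom_comp_brHom _ (R.abuts_β ε)
        ((T (R.ν ε)).isVerticialHom_decompHomCont_chart hcof hcn hS hfin hne), by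
        rw [branchSubgroup, MonoidHom.map_range]; rfl⟩
  rw [R.edgeOf_β] at hmem
  simpa only [GaloisLevelData.piPresentation_M] using hmem

/-- The positioned vertex groups `g H_w g⁻¹` of the presentation are verticial for `D.chart`.
[cite: MochizukiSemiAnbd2006, Thm 3.7(i) p.40] -/
theorem piPresentation_map_conj_H_mem_verticialSubgroups_chart (w : 𝒢.graph.Vertex)
    (g : (D.chart h𝒢 hcof hcn hS hfin hne).G) :
    ((D.piPresentation h𝒢 T R).H w).map (MulAut.conj g).toMonoidHom ∈ verticialSubgroups (D.chart h𝒢 hcof hcn hS hfin hne) w := by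
  rw [D.piPresentation_H h𝒢 T R]
  exact conj_mem_verticialSubgroups _
    ((T w).range_decompHom_mem_verticialSubgroups_chart hcof hcn hS hfin hne) g

include hcof hcn hS hfin hne in
/-- The vertex groups of the presentation are self-normalising, under the Thm 3.7 hypotheses
(abc-iut-w4-d082's `piPresentation_selfNormalizing` at `D.chart`). [cite: MochizukiSemiAnbd2006, Thm 3.7(iii) p.41] -/
theorem piPresentation_selfNormalizing_chart (h37 : 𝒢.Thm37Hypotheses) (w : 𝒢.graph.Vertex)
    (n : D.temperedPi h𝒢) (hn : ∀ x, x ∈ (D.piPresentation h𝒢 T R).H w ↔ n⁻¹ * x * n ∈ (D.piPresentation h𝒢 T R).H w) : n ∈ (D.piPresentation h𝒢 T R).H w :=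
  mem_of_map_conj_eq_of_mem_verticialSubgroups verticialDistinct_holds h37 (D.chart h𝒢 hcof hcn hS hfin hne)
    (by rw [D.piPresentation_H h𝒢 T R]
        exact (T w).range_decompHom_mem_verticialSubgroups_chart hcof hcn hS hfin hne)
    (map_conj_eq_of_forall_mem_iff_aux _ n hn)

variable {PA : Type w} [Group PA] (ρ : PA →* TopOut (D.chart h𝒢 hcof hcn hS hfin hne).G) (baseAct : PA →* Aut 𝒢.graph)

/-- Vertex conjugators (conjugation form) for the outer model at `D.chart`, from the chart binder `hV`
(abc-iut-w4-d082's `piPresentation_exists_isVConj_outerAction` at the chart of the tower).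
[cite: MochizukiSemiAnbd2006, §5, p. 65] -/
theorem piPresentation_hVconj_outerAction_chart (h36 : 𝒢.Prop36Hypotheses)
    (hV : ∀ (a : PA) (v : 𝒢.graph.Vertex) (H : Subgroup (D.chart h𝒢 hcof hcn hS hfin hne).G), H ∈ verticialSubgroups (D.chart h𝒢 hcof hcn hS hfin hne) v →
      ∃ φ : contMulAut (D.chart h𝒢 hcof hcn hS hfin hne).G, TopOut.mk _ φ = ρ a ∧
        H.map (φ : MulAut (D.chart h𝒢 hcof hcn hS hfin hne).G).toMonoidHom ∈ verticialSubgroups (D.chart h𝒢 hcof hcn hS hfin hne) ((baseAct a).hom.vertexMap v))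
    (e : outerSemidirectProduct ρ) (w : 𝒢.graph.Vertex) :
    ∃ k : (D.chart h𝒢 hcof hcn hS hfin hne).G,
      ((D.piPresentation h𝒢 T R).H w).map ((((contMulAut (D.chart h𝒢 hcof hcn hS hfin hne).G).subtype.comp (MonoidHom.fst _ _)).comp
          (outerSemidirectProduct ρ).subtype) e).toMonoidHom =
        ((D.piPresentation h𝒢 T R).H (((baseAct.comp (outerSemidirectProductSnd ρ)) e).hom.vertexMap w)).map
          (MulAut.conj k).toMonoidHom := by
  have _ := h36
  obtain ⟨k, hk⟩ := exists_vConj_outerAction (D.chart h𝒢 hcof hcn hS hfin hne) ρ baseAct hV (fun w => (D.piPresentation h𝒢 T R).H w)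
    (fun w => by
      rw [D.piPresentation_H h𝒢 T R]
      exact (T w).range_decompHom_mem_verticialSubgroups_chart hcof hcn hS hfin hne) e w
  exact ⟨k, SemiGraph.SubgroupPresentation.map_eq_of_isVConj _ hk⟩

/-- **The pair transport (BR) in presentation currency at `D.chart`** (this seat's
`piPresentation_hBR_outerAction` at the chart of the tower). [cite: MochizukiSemiAnbd2006, Def 5.1 (i), p. 62] -/
theorem piPresentation_hBR_outerAction_chart (h36 : 𝒢.Prop36Hypotheses)
    (hBR : ∀ (a : PA) (b : 𝒢.graph.Branch) (v : 𝒢.graph.Vertex) (hb : 𝒢.graph.abuts b = some v)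
      (φ : 𝒢.Gv v →ₜ* (D.chart h𝒢 hcof hcn hS hfin hne).G), IsVerticialHom (D.chart h𝒢 hcof hcn hS hfin hne) v φ →
      ∃ Φ : contMulAut (D.chart h𝒢 hcof hcn hS hfin hne).G, TopOut.mk _ Φ = ρ a ∧
        ∃ φ' : 𝒢.Gv ((baseAct a).hom.vertexMap v) →ₜ* (D.chart h𝒢 hcof hcn hS hfin hne).G,
          IsVerticialHom (D.chart h𝒢 hcof hcn hS hfin hne) ((baseAct a).hom.vertexMap v) φ' ∧
          ∃ x' : (D.chart h𝒢 hcof hcn hS hfin hne).G,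
            Subgroup.map (Φ : MulAut (D.chart h𝒢 hcof hcn hS hfin hne).G).toMonoidHom φ.toMonoidHom.range =
              Subgroup.map (MulAut.conj x').toMonoidHom φ'.toMonoidHom.range ∧
            Subgroup.map (Φ : MulAut (D.chart h𝒢 hcof hcn hS hfin hne).G).toMonoidHom
                (Subgroup.map φ.toMonoidHom (𝒢.branchSubgroup b v hb)) =
              Subgroup.map (MulAut.conj x').toMonoidHom
                (Subgroup.map φ'.toMonoidHom
                  (𝒢.branchSubgroup ((baseAct a).hom.branchMap b) ((baseAct a).hom.vertexMap v)
                    ((baseAct a).hom.abuts_branchMap b v hb))))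
    (e : outerSemidirectProduct ρ) (b : 𝒢.graph.Branch) (w : 𝒢.graph.Vertex)
    (hw : 𝒢.graph.abuts b = some w) :
    ∃ k : (D.chart h𝒢 hcof hcn hS hfin hne).G,
      ((D.piPresentation h𝒢 T R).H w).map ((((contMulAut (D.chart h𝒢 hcof hcn hS hfin hne).G).subtype.comp (MonoidHom.fst _ _)).comp
            (outerSemidirectProduct ρ).subtype) e).toMonoidHom =
        ((D.piPresentation h𝒢 T R).H (((baseAct.comp (outerSemidirectProductSnd ρ)) e).hom.vertexMap w)).map
          (MulAut.conj k).toMonoidHom ∧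
      (((D.piPresentation h𝒢 T R).M (𝒢.graph.edgeOf b)).map (MulAut.conj ((D.piPresentation h𝒢 T R).s b)).toMonoidHom).map
          ((((contMulAut (D.chart h𝒢 hcof hcn hS hfin hne).G).subtype.comp (MonoidHom.fst _ _)).comp
            (outerSemidirectProduct ρ).subtype) e).toMonoidHom =
        (((D.piPresentation h𝒢 T R).M (𝒢.graph.edgeOf (((baseAct.comp (outerSemidirectProductSnd ρ)) e).hom.branchMap b))).map
            (MulAut.conj ((D.piPresentation h𝒢 T R).s (((baseAct.comp (outerSemidirectProductSnd ρ)) e).hom.branchMap b))).toMonoidHom).map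
          (MulAut.conj k).toMonoidHom := by
  have hinj : Function.Injective (toOuterSemidirectProduct ρ) := (outerAction_exact (D.chart h𝒢 hcof hcn hS hfin hne) ρ h36).1
  obtain ⟨φ', hφ', x', h1, h2⟩ := conj_branchPair_outerAction (D.chart h𝒢 hcof hcn hS hfin hne) ρ baseAct hBR e b w hw
    (T w).decompHomCont ((T w).isVerticialHom_decompHomCont_chart hcof hcn hS hfin hne) 1
  rw [conjSubgroup_map_toOuterSemidirectProduct] at h1 h2
  have h1' := Subgroup.map_injective hinj h1
  have h2' := Subgroup.map_injective hinj h2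
  rw [SemiGraph.SubgroupPresentation.map_conj_one'] at h1' h2'
  obtain ⟨g, hg⟩ := exists_conj_of_isVerticialHom (D.chart h𝒢 hcof hcn hS hfin hne) φ'
    (T ((baseAct (outerSemidirectProductSnd ρ e)).hom.vertexMap w)).decompHomCont hφ'
    ((T ((baseAct (outerSemidirectProductSnd ρ e)).hom.vertexMap w)).isVerticialHom_decompHomCont_chart
      hcof hcn hS hfin hne)
  have hH' : φ'.toMonoidHom.range.map (MulAut.conj g).toMonoidHom =
      (D.piPresentation h𝒢 T R).H ((baseAct (outerSemidirectProductSnd ρ e)).hom.vertexMap w) := by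
    rw [D.piPresentation_H h𝒢 T R]
    exact map_conj_range_eq_of_forall _ _ g hg
  have hB' : ((𝒢.branchSubgroup ((baseAct (outerSemidirectProductSnd ρ e)).hom.branchMap b)
        ((baseAct (outerSemidirectProductSnd ρ e)).hom.vertexMap w)
        ((baseAct (outerSemidirectProductSnd ρ e)).hom.abuts_branchMap b w hw)).map φ'.toMonoidHom).map
        (MulAut.conj g).toMonoidHom =
      ((D.piPresentation h𝒢 T R).M (𝒢.graph.edgeOf ((baseAct (outerSemidirectProductSnd ρ e)).hom.branchMap b))).map
        (MulAut.conj ((D.piPresentation h𝒢 T R).s ((baseAct (outerSemidirectProductSnd ρ e)).hom.branchMap b))).toMonoidHom := by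
    rw [D.map_conj_s_piPresentation_M h𝒢 T R _ _
      ((baseAct (outerSemidirectProductSnd ρ e)).hom.abuts_branchMap b w hw)]
    exact map_conj_map_eq_of_forall _ _ g hg _
  refine ⟨x' * g⁻¹, ?_, ?_⟩
  · simp only [MonoidHom.comp_apply]
    rw [← hH', SemiGraph.SubgroupPresentation.map_conj_map_conj', inv_mul_cancel_right]
    exact h1'
  · simp only [MonoidHom.comp_apply]
    rw [← hB', SemiGraph.SubgroupPresentation.map_conj_map_conj', inv_mul_cancel_right,
      D.map_conj_s_piPresentation_M h𝒢 T R b w hw]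
    exact h2'

include hcof hcn hS hfin hne in
/-- **Distinct ends `hNe` at `D.chart`** (this seat's `piPresentation_hNe` at the chart of the tower).
[cite: MochizukiSemiAnbd2006, Thm 3.7(iv) p.41] -/
theorem piPresentation_hNe_chart (h37 : 𝒢.Thm37Hypotheses) :
    ∀ (b₁ b₂ : 𝒢.graph.Branch) (w₁ w₂ : 𝒢.graph.Vertex), b₁ ≠ b₂ → 𝒢.graph.edgeOf b₁ = 𝒢.graph.edgeOf b₂ →
      𝒢.graph.abuts b₁ = some w₁ → 𝒢.graph.abuts b₂ = some w₂ →
      ((D.piPresentation h𝒢 T R).H w₁).map (MulAut.conj ((D.piPresentation h𝒢 T R).s b₁)⁻¹).toMonoidHom ≠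
      ((D.piPresentation h𝒢 T R).H w₂).map (MulAut.conj ((D.piPresentation h𝒢 T R).s b₂)⁻¹).toMonoidHom := by
  intro b₁ b₂ w₁ w₂ h12 he hw₁ hw₂ hEq
  have hEI := D.piPresentation_hEI h𝒢 T R b₁ b₂ w₁ w₂ h12 he hw₁ hw₂
  have hM : (D.piPresentation h𝒢 T R).M (𝒢.graph.edgeOf b₁) = ((D.piPresentation h𝒢 T R).H w₁).map (MulAut.conj ((D.piPresentation h𝒢 T R).s b₁)⁻¹).toMonoidHom := by
    ext x
    rw [hEI x, mem_map_conj_inv_iff]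
    constructor
    · exact fun h => h.1
    · intro h
      refine ⟨h, ?_⟩
      rw [← mem_map_conj_inv_iff, ← hEq, mem_map_conj_inv_iff]
      exact h
  have hMedge := piPresentation_M_mem_edgeLikeSubgroups_chart D h𝒢 hcof hcn hS hfin hne T R
    (𝒢.graph.edgeOf b₁)
  rw [hM] at hMedge
  exact not_mem_edgeLikeSubgroups_of_mem_verticialSubgroups h37 _
    (piPresentation_map_conj_H_mem_verticialSubgroups_chart D h𝒢 hcof hcn hS hfin hne T R w₁ _) hMedge

/-- **Two hosts `hTwo` at `D.chart`** (this seat's `piPresentation_hTwo` at the chart of the tower).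
[cite: MochizukiSemiAnbd2006, Thm 3.7(iii) p.41] -/
theorem piPresentation_hTwo_chart (h37 : 𝒢.Thm37Hypotheses) (hCIV : CompactInVerticialAt 𝒢) :
    ∀ (b₁ b₂ : 𝒢.graph.Branch) (w₁ w₂ : 𝒢.graph.Vertex), b₁ ≠ b₂ → 𝒢.graph.edgeOf b₁ = 𝒢.graph.edgeOf b₂ →
      𝒢.graph.abuts b₁ = some w₁ → 𝒢.graph.abuts b₂ = some w₂ →
      ∀ (w : 𝒢.graph.Vertex) (g : (D.chart h𝒢 hcof hcn hS hfin hne).G),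
      (D.piPresentation h𝒢 T R).M (𝒢.graph.edgeOf b₁) ≤ ((D.piPresentation h𝒢 T R).H w).map (MulAut.conj g).toMonoidHom →
      ((D.piPresentation h𝒢 T R).H w).map (MulAut.conj g).toMonoidHom =
        ((D.piPresentation h𝒢 T R).H w₁).map (MulAut.conj ((D.piPresentation h𝒢 T R).s b₁)⁻¹).toMonoidHom ∨
      ((D.piPresentation h𝒢 T R).H w).map (MulAut.conj g).toMonoidHom =
        ((D.piPresentation h𝒢 T R).H w₂).map (MulAut.conj ((D.piPresentation h𝒢 T R).s b₂)⁻¹).toMonoidHom := by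
  intro b₁ b₂ w₁ w₂ h12 he hw₁ hw₂ w g hle
  have hC := D.isCompact_piPresentation_M h𝒢 T R (𝒢.graph.edgeOf b₁)
  have hMedge := piPresentation_M_mem_edgeLikeSubgroups_chart D h𝒢 hcof hcn hS hfin hne T R
    (𝒢.graph.edgeOf b₁)
  have hne' := ne_bot_of_mem_edgeLikeSubgroups verticialInjective_holds h37 _ hMedge
  obtain ⟨-, h2⟩ := hCIV h37 (D.chart h𝒢 hcof hcn hS hfin hne) _ hC
  obtain ⟨huniq, -⟩ := h2 hne' w₁ w₂ _ _
    (piPresentation_map_conj_H_mem_verticialSubgroups_chart D h𝒢 hcof hcn hS hfin hne T R w₁ _)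
    (piPresentation_map_conj_H_mem_verticialSubgroups_chart D h𝒢 hcof hcn hS hfin hne T R w₂ _)
    (piPresentation_hNe_chart D h𝒢 hcof hcn hS hfin hne T R h37 b₁ b₂ w₁ w₂ h12 he hw₁ hw₂)
    (SemiGraph.SubgroupPresentation.M_le_map_conj_inv_s _ b₁ w₁ hw₁)
    (he ▸ SemiGraph.SubgroupPresentation.M_le_map_conj_inv_s _ b₂ w₂ hw₂)
  exact huniq w _ (piPresentation_map_conj_H_mem_verticialSubgroups_chart D h𝒢 hcof hcn hS hfin hne T R w g)
    hle

/-- **`IsArithCompatible` for the presentation of `𝔾` in `π₁^temp(𝒢)` at ANY cofinal Galois tower `D`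
and its chart `D.chart`, for the outer model `π₁^temp(𝒢) ⋊^out_ρ Π_A`**, from the Def 5.1 (i) chart
binders `hV`, `hBR` (read at `D.chart`), the print hypotheses `Thm37Hypotheses`, `IsGraph`, and Thm 3.7
(iii) at `𝒢` — the `hP` input of the capstone at the E1-junction's characteristic tower.
[cite: MochizukiSemiAnbd2006, Thm 5.4, p. 66] -/
theorem isArithCompatible_piPresentation_outerAction_of_branchPair_chart (h37 : 𝒢.Thm37Hypotheses)
    (hG : 𝒢.graph.IsGraph) (hCIV : CompactInVerticialAt 𝒢)
    (hV : ∀ (a : PA) (v : 𝒢.graph.Vertex) (H : Subgroup (D.chart h𝒢 hcof hcn hS hfin hne).G), H ∈ verticialSubgroups (D.chart h𝒢 hcof hcn hS hfin hne) v →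
      ∃ φ : contMulAut (D.chart h𝒢 hcof hcn hS hfin hne).G, TopOut.mk _ φ = ρ a ∧
        H.map (φ : MulAut (D.chart h𝒢 hcof hcn hS hfin hne).G).toMonoidHom ∈ verticialSubgroups (D.chart h𝒢 hcof hcn hS hfin hne) ((baseAct a).hom.vertexMap v))
    (hBR : ∀ (a : PA) (b : 𝒢.graph.Branch) (v : 𝒢.graph.Vertex) (hb : 𝒢.graph.abuts b = some v)
      (φ : 𝒢.Gv v →ₜ* (D.chart h𝒢 hcof hcn hS hfin hne).G), IsVerticialHom (D.chart h𝒢 hcof hcn hS hfin hne) v φ →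
      ∃ Φ : contMulAut (D.chart h𝒢 hcof hcn hS hfin hne).G, TopOut.mk _ Φ = ρ a ∧
        ∃ φ' : 𝒢.Gv ((baseAct a).hom.vertexMap v) →ₜ* (D.chart h𝒢 hcof hcn hS hfin hne).G,
          IsVerticialHom (D.chart h𝒢 hcof hcn hS hfin hne) ((baseAct a).hom.vertexMap v) φ' ∧
          ∃ x' : (D.chart h𝒢 hcof hcn hS hfin hne).G,
            Subgroup.map (Φ : MulAut (D.chart h𝒢 hcof hcn hS hfin hne).G).toMonoidHom φ.toMonoidHom.range =
              Subgroup.map (MulAut.conj x').toMonoidHom φ'.toMonoidHom.range ∧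
            Subgroup.map (Φ : MulAut (D.chart h𝒢 hcof hcn hS hfin hne).G).toMonoidHom
                (Subgroup.map φ.toMonoidHom (𝒢.branchSubgroup b v hb)) =
              Subgroup.map (MulAut.conj x').toMonoidHom
                (Subgroup.map φ'.toMonoidHom
                  (𝒢.branchSubgroup ((baseAct a).hom.branchMap b) ((baseAct a).hom.vertexMap v)
                    ((baseAct a).hom.abuts_branchMap b v hb)))) :
    (D.piPresentation h𝒢 T R).IsArithCompatible
      (((contMulAut (D.chart h𝒢 hcof hcn hS hfin hne).G).subtype.comp (MonoidHom.fst _ _)).comp (outerSemidirectProduct ρ).subtype)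
      (baseAct.comp (outerSemidirectProductSnd ρ)) :=
  SemiGraph.SubgroupPresentation.isArithCompatible_of_pairTransport _ _ _
    (piPresentation_selfNormalizing_chart D h𝒢 hcof hcn hS hfin hne T R h37) hG.abuts_isSome
    (D.piPresentation_hEI h𝒢 T R)
    (piPresentation_hVconj_outerAction_chart D h𝒢 hcof hcn hS hfin hne T R ρ baseAct
      h37.toProp36Hypotheses hV)
    (piPresentation_hBR_outerAction_chart D h𝒢 hcof hcn hS hfin hne T R ρ baseAct
      h37.toProp36Hypotheses hBR)
    (piPresentation_hTwo_chart D h𝒢 hcof hcn hS hfin hne T R h37 hCIV)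
    (piPresentation_hNe_chart D h𝒢 hcof hcn hS hfin hne T R h37)

/-- The same at a FINITE graph, with Thm 3.7 (iii) at `𝒢` supplied by abc-iut-L3-t8's
`compactInVerticialAt_of_finiteGraph`: `hP` at ANY tower modulo `hV`/`hBR` only.
[cite: MochizukiSemiAnbd2006, Thm 5.4, p. 66] -/
theorem isArithCompatible_piPresentation_outerAction_of_branchPair_chart_of_finite
    [Finite 𝒢.graph.Vertex] [Finite 𝒢.graph.Edge] (h37 : 𝒢.Thm37Hypotheses) (hG : 𝒢.graph.IsGraph)
    (hV : ∀ (a : PA) (v : 𝒢.graph.Vertex) (H : Subgroup (D.chart h𝒢 hcof hcn hS hfin hne).G), H ∈ verticialSubgroups (D.chart h𝒢 hcof hcn hS hfin hne) v →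
      ∃ φ : contMulAut (D.chart h𝒢 hcof hcn hS hfin hne).G, TopOut.mk _ φ = ρ a ∧
        H.map (φ : MulAut (D.chart h𝒢 hcof hcn hS hfin hne).G).toMonoidHom ∈ verticialSubgroups (D.chart h𝒢 hcof hcn hS hfin hne) ((baseAct a).hom.vertexMap v))
    (hBR : ∀ (a : PA) (b : 𝒢.graph.Branch) (v : 𝒢.graph.Vertex) (hb : 𝒢.graph.abuts b = some v)
      (φ : 𝒢.Gv v →ₜ* (D.chart h𝒢 hcof hcn hS hfin hne).G), IsVerticialHom (D.chart h𝒢 hcof hcn hS hfin hne) v φ →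
      ∃ Φ : contMulAut (D.chart h𝒢 hcof hcn hS hfin hne).G, TopOut.mk _ Φ = ρ a ∧
        ∃ φ' : 𝒢.Gv ((baseAct a).hom.vertexMap v) →ₜ* (D.chart h𝒢 hcof hcn hS hfin hne).G,
          IsVerticialHom (D.chart h𝒢 hcof hcn hS hfin hne) ((baseAct a).hom.vertexMap v) φ' ∧
          ∃ x' : (D.chart h𝒢 hcof hcn hS hfin hne).G,
            Subgroup.map (Φ : MulAut (D.chart h𝒢 hcof hcn hS hfin hne).G).toMonoidHom φ.toMonoidHom.range =
              Subgroup.map (MulAut.conj x').toMonoidHom φ'.toMonoidHom.range ∧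
            Subgroup.map (Φ : MulAut (D.chart h𝒢 hcof hcn hS hfin hne).G).toMonoidHom
                (Subgroup.map φ.toMonoidHom (𝒢.branchSubgroup b v hb)) =
              Subgroup.map (MulAut.conj x').toMonoidHom
                (Subgroup.map φ'.toMonoidHom
                  (𝒢.branchSubgroup ((baseAct a).hom.branchMap b) ((baseAct a).hom.vertexMap v)
                    ((baseAct a).hom.abuts_branchMap b v hb)))) :
    (D.piPresentation h𝒢 T R).IsArithCompatible
      (((contMulAut (D.chart h𝒢 hcof hcn hS hfin hne).G).subtype.comp (MonoidHom.fst _ _)).comp (outerSemidirectProduct ρ).subtype)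
      (baseAct.comp (outerSemidirectProductSnd ρ)) :=
  isArithCompatible_piPresentation_outerAction_of_branchPair_chart D h𝒢 hcof hcn hS hfin hne T R ρ baseAct
    h37 hG 𝒢.compactInVerticialAt_of_finiteGraph hV hBR

end Chart

end ProfiniteSemiGraph

end Literature.AnabelianGeometry.SemiGraphs
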